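import Mathlib.Analysis.Analytic.Order
import Mathlib.Analysis.Analytic.OfScalars
import Literature.NumberTheory.Transcendental.PadicExpBallProofs
import Literature.NumberTheory.Transcendental.PadicSchwarzLemma
import Literature.NumberTheory.Transcendental.PadicLogAlgClProofs
import HarnessLib

/-!
# Brumer's `p`-adic analogue of Baker's theorem — analytic preliminaries

Topic `Literature/NumberTheory/Transcendental`; namespace
`Literature.NumberTheory.Transcendental.BrumerPadic`.  Support for the proof of the named fact
`Literature.NumberTheory.Transcendental.brumer1967_thm1` (`BrumerPadicBaker.lean`; A. Brumer,
*On the units of algebraic number fields*, Mathematika **14** (1967) 121–124, Theorem 1), which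
follows A. Baker, *Transcendental Number Theory* (1975), Ch. 2 (the tree's sorry-free complex
proof `BakerLogarithms*.lean`) with the `p`-adic modifications of the analytic steps.  Brumer
(loc. cit.) obtains Theorem 1 "by the method of Baker" in the `p`-adic domain; the two analytic
devices of Baker's Lemmas 4–5 (maximum modulus principle with multiplicities, Cauchy's
inequality) are replaced by the ultrametric Schwarz lemma, and the complex exponential by the
`p`-adic one on its disc of convergence.  Everything in this file is **proved**; there are no
definitions and no named facts.

## Contents

* §1 (any complete ultrametric field `K`): `norm_tsum_mul_pow_le_mul_prod_pow` — the
  **ultrametric Schwarz lemma with multiplicities**: if `G(z) = ∑ bₙ zⁿ`, `‖bₙ‖ ≤ B`, vanishes to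
  order `≥ ν(a)` (Mathlib's `analyticOrderAt`) at the points `a` of a finite subset `s` of the open
  unit disc, then `‖G(z)‖ ≤ B ∏_{a ∈ s} ‖z − a‖^{ν(a)}` for `‖z‖ < 1` (induction on `∑ ν`, dividing
  out one zero at a time with the tree's `tsum_mul_pow_eq_sub_mul_tsum` and tracking orders with
  Mathlib's `analyticOrderAt_mul`).
* §2 (a complete ultrametric normed `ℚ_p`-algebra field `E`): the exponential `u ↦ exp (ψ u)` for
  `‖ψ‖ < p⁻¹` on the closed unit disc — radius of the exponential series of `E` over itself
  (`le_expSeries_radius_self`), analyticity and derivative (`analyticAt_exp_mul`,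
  `hasDerivAt_exp_mul`), its expansion `∑ (ψᵏ/k!) uᵏ` with coefficients of norm `≤ 1`
  (`hasSum_exp_mul`, `norm_pow_div_factorial_le_one`).
* §3: `norm_expSum_le_of_iteratedDeriv_eq_zero` — the Schwarz lemma for **exponential sums**
  `f(u) = ∑ᵢ cᵢ exp (ψᵢ u)`: if all derivatives of order `< S` of `f` vanish at the points of `s`,
  then `‖f(z)‖ ≤ C ∏_{a ∈ s} ‖z − a‖^S` (`‖cᵢ‖ ≤ C`).  This is the extrapolation device of the
  `p`-adic proof (in place of Baker 1975, Ch. 2, Lemma 4's maximum modulus argument).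
* §4: `logSeries_exp` — `L(exp c) = c` for `‖c‖ < p⁻¹`, `L(y) = ∑ −(1−y)ⁿ⁺¹/(n+1)` the logarithmic
  series (from the tree's limit formula `IwasawaLog.tendsto_pow_prime_pow_sub_one_div` and
  `‖exp a − 1 − a‖ ≤ p‖a‖²`), used to pass from `log_p αᵢ` to exponents `ℓᵢ` with `αᵢ = exp ℓᵢ`.

## References

* [Brumer1967] A. Brumer, *On the units of algebraic number fields*, Mathematika 14 (1967),
  121–124, Theorem 1 (statement; proof "by Baker's method").
* [BakerTNT1975] A. Baker, *Transcendental Number Theory*, CUP 1975, Ch. 2, Lemmas 4–5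
  (pp. 23–24) — the complex extrapolation step whose `p`-adic substitute is §3.
* A. M. Robert, *A Course in `p`-adic Analysis*, GTM 198, Ch. 6 §2 (zeros of power series).
-/

noncomputable section

open NormedSpace Filter Metric Finset
open _root_.Topology
open scoped Nat ENNReal NNReal

namespace Literature.NumberTheory.Transcendental

namespace BrumerPadic

/-! ### §1. The ultrametric Schwarz lemma with multiplicities -/

section Schwarz

variable {K : Type*} [NontriviallyNormedField K] [IsUltrametricDist K] [CompleteSpace K]

omit [IsUltrametricDist K] in
/-- A power series with bounded coefficients is analytic at every point of the open unit disc
(its radius of convergence is at least `1`). [folklore] -/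
theorem analyticAt_tsum_mul_pow {b : ℕ → K} {B : ℝ} (hb : ∀ n, ‖b n‖ ≤ B) {a : K}
    (ha : ‖a‖ < 1) : AnalyticAt K (fun z => ∑' n, b n * z ^ n) a := by
  set q : FormalMultilinearSeries K K K := FormalMultilinearSeries.ofScalars K b with hq
  have hrad : ((1 : ℝ≥0) : ℝ≥0∞) ≤ q.radius := by
    refine q.le_radius_of_bound B fun n => ?_
    rw [NNReal.coe_one, one_pow, mul_one, hq, FormalMultilinearSeries.ofScalars_norm]
    exact hb n
  have hpos : 0 < q.radius := lt_of_lt_of_le (by simp) hrad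
  have hG : HasFPowerSeriesOnBall q.sum q 0 q.radius := q.hasFPowerSeriesOnBall hpos
  have hfun : (fun z : K => ∑' n, b n * z ^ n) = q.sum := by
    funext z
    change _ = FormalMultilinearSeries.ofScalarsSum (E := K) b z
    rw [FormalMultilinearSeries.ofScalars_sum_eq]
    simp only [smul_eq_mul]
  rw [hfun]
  refine hG.analyticAt_of_mem ?_
  rw [Metric.mem_eball, edist_zero_right]
  refine lt_of_lt_of_le ?_ hrad
  rw [enorm_eq_nnnorm, ENNReal.coe_lt_coe, ← NNReal.coe_lt_coe, coe_nnnorm, NNReal.coe_one]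
  exact ha

omit [IsUltrametricDist K] [CompleteSpace K] in
/-- The open unit disc is a neighbourhood of each of its points. [folklore] -/
theorem ball_one_mem_nhds {a : K} (ha : ‖a‖ < 1) : {z : K | ‖z‖ < 1} ∈ 𝓝 a := by
  have : {z : K | ‖z‖ < 1} = Metric.ball (0 : K) 1 := by
    ext z; simp
  rw [this]
  exact Metric.isOpen_ball.mem_nhds (by simpa using ha)

omit [IsUltrametricDist K] [CompleteSpace K] in
/-- `analyticOrderAt (· - a₀) a` is `1` at `a = a₀`. [folklore] -/
theorem analyticOrderAt_sub_self (a₀ : K) : analyticOrderAt (fun z : K => z - a₀) a₀ = 1 := by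
  have h := analyticOrderAt_centeredMonomial (𝕜 := K) (z₀ := a₀) (n := 1)
  simpa using h

omit [IsUltrametricDist K] [CompleteSpace K] in
/-- `analyticOrderAt (· - a₀) a` is `0` at `a ≠ a₀`. [folklore] -/
theorem analyticOrderAt_sub_of_ne {a₀ a : K} (h : a ≠ a₀) :
    analyticOrderAt (fun z : K => z - a₀) a = 0 := by
  rw [AnalyticAt.analyticOrderAt_eq_zero (by fun_prop)]
  exact sub_ne_zero.mpr h

omit [IsUltrametricDist K] [CompleteSpace K] in
/-- `ℕ∞` bookkeeping: `n ≤ 1 + m ⇒ n - 1 ≤ m`. [folklore] -/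
theorem natCast_sub_one_le_of_le_one_add {n : ℕ} {m : ℕ∞} (h : (n : ℕ∞) ≤ 1 + m) :
    ((n - 1 : ℕ) : ℕ∞) ≤ m := by
  induction m using ENat.recTopCoe with
  | top => exact le_top
  | coe m =>
    have h' : n ≤ 1 + m := by exact_mod_cast h
    exact_mod_cast (by omega : n - 1 ≤ m)

/-- **The ultrametric Schwarz lemma with multiplicities.**  Let `G(z) = ∑ bₙ zⁿ` with
`‖bₙ‖ ≤ B`, let `s` be a finite subset of the open unit disc and `ν : K → ℕ`; if `G` vanishes to
order at least `ν(a)` at every `a ∈ s` (i.e. `ν(a) ≤ analyticOrderAt G a`), then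
`‖G(z)‖ ≤ B · ∏_{a ∈ s} ‖z − a‖^{ν(a)}` for all `‖z‖ < 1`.  (Divide out the zeros one at a time:
`G = (z − a₀) H` with `H` again bounded by `B`, and the orders of `H` are those of `G` lowered by
one at `a₀`, by additivity of `analyticOrderAt`.)  This is the non-archimedean substitute for the
maximum-modulus step of Baker 1975, Ch. 2, Lemma 4. [folklore] -/
theorem norm_tsum_mul_pow_le_mul_prod_pow (s : Finset K) (hs : ∀ a ∈ s, ‖a‖ < 1) :
    ∀ (N : ℕ) (ν : K → ℕ) {b : ℕ → K} {B : ℝ}, ∑ a ∈ s, ν a = N → (∀ n, ‖b n‖ ≤ B) →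
      (∀ a ∈ s, (ν a : ℕ∞) ≤ analyticOrderAt (fun z => ∑' n, b n * z ^ n) a) →
        ∀ {z : K}, ‖z‖ < 1 → ‖∑' n, b n * z ^ n‖ ≤ B * ∏ a ∈ s, ‖z - a‖ ^ ν a := by
  classical
  intro N
  induction N with
  | zero =>
    intro ν b B hN hb _ z hz
    have hB : 0 ≤ B := (norm_nonneg _).trans (hb 0)
    have hν : ∀ a ∈ s, ν a = 0 := fun a ha => by
      have := Finset.sum_eq_zero_iff.mp hN a ha
      exact this
    rw [Finset.prod_congr rfl fun a ha => by rw [hν a ha, pow_zero], Finset.prod_const_one,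
      mul_one]
    exact norm_tsum_mul_pow_le hB hb hz.le
  | succ N ih =>
    intro ν b B hN hb hord z hz
    have hB : 0 ≤ B := (norm_nonneg _).trans (hb 0)
    -- a point `a₀ ∈ s` with positive multiplicity
    obtain ⟨a₀, ha₀s, hν₀⟩ : ∃ a₀ ∈ s, 0 < ν a₀ := by
      by_contra hcon
      push Not at hcon
      have : ∑ a ∈ s, ν a = 0 := Finset.sum_eq_zero fun a ha => Nat.le_zero.mp (hcon a ha)
      omega
    have ha₀ : ‖a₀‖ < 1 := hs a₀ ha₀s
    set G : K → K := fun z => ∑' n, b n * z ^ n with hG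
    -- `G(a₀) = 0`
    have hGa₀ : G a₀ = 0 := by
      refine apply_eq_zero_of_analyticOrderAt_ne_zero ?_
      intro h0
      have h1 := hord a₀ ha₀s
      rw [h0] at h1
      have : (ν a₀ : ℕ∞) = 0 := nonpos_iff_eq_zero.mp h1
      exact hν₀.ne' (by exact_mod_cast this)
    -- divide by the zero: `G = (z - a₀) H`
    set h : ℕ → K := fun n => ∑' k, b (n + 1 + k) * a₀ ^ k with hh
    have hhB : ∀ n, ‖h n‖ ≤ B := fun n => norm_tsum_shift_mul_pow_le hB hb ha₀.le n
    set H : K → K := fun z => ∑' n, h n * z ^ n with hH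
    have hdiv : ∀ {w : K}, ‖w‖ < 1 → G w = (w - a₀) * H w :=
      fun hw => tsum_mul_pow_eq_sub_mul_tsum hb ha₀ hGa₀ hw
    -- orders of `H`
    obtain ⟨ν', hν'⟩ : ∃ ν' : K → ℕ, ∀ a, ν' a = if a = a₀ then ν a - 1 else ν a :=
      ⟨_, fun a => rfl⟩
    have hsum' : ∑ a ∈ s, ν' a = N := by
      have e1 : ∑ a ∈ s, ν a = ν a₀ + ∑ a ∈ s.erase a₀, ν a :=
        (Finset.add_sum_erase s ν ha₀s).symm
      have e2 : ∑ a ∈ s, ν' a = ν' a₀ + ∑ a ∈ s.erase a₀, ν' a :=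
        (Finset.add_sum_erase s ν' ha₀s).symm
      have e3 : ∑ a ∈ s.erase a₀, ν' a = ∑ a ∈ s.erase a₀, ν a :=
        Finset.sum_congr rfl fun a ha => by
          rw [hν' a, if_neg (Finset.ne_of_mem_erase ha)]
      have e4 : ν' a₀ = ν a₀ - 1 := by rw [hν' a₀, if_pos rfl]
      omega
    have hord' : ∀ a ∈ s, (ν' a : ℕ∞) ≤ analyticOrderAt H a := by
      intro a ha
      have ha1 : ‖a‖ < 1 := hs a ha
      have hGH : G =ᶠ[𝓝 a] fun w => (w - a₀) * H w := by
        filter_upwards [ball_one_mem_nhds ha1] with w hw using hdiv hw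
      have hHan : AnalyticAt K H a := analyticAt_tsum_mul_pow hhB ha1
      have hlin : AnalyticAt K (fun w : K => w - a₀) a := by fun_prop
      have hmul := analyticOrderAt_mul hlin hHan
      have hGord : analyticOrderAt G a =
          analyticOrderAt (fun w : K => w - a₀) a + analyticOrderAt H a := by
        rw [analyticOrderAt_congr hGH, ← hmul]
        rfl
      have h1 := hord a ha
      change (ν a : ℕ∞) ≤ analyticOrderAt G a at h1
      rw [hGord] at h1
      by_cases haa : a = a₀
      · subst haa
        rw [analyticOrderAt_sub_self] at h1
        rw [hν' a, if_pos rfl]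
        exact natCast_sub_one_le_of_le_one_add h1
      · rw [analyticOrderAt_sub_of_ne haa, zero_add] at h1
        rw [hν' a, if_neg haa]
        exact h1
    -- induction hypothesis for `H`
    have hHz := ih ν' hsum' hhB hord' hz
    -- assemble
    have hprod : ∏ a ∈ s, ‖z - a‖ ^ ν a = ‖z - a₀‖ * ∏ a ∈ s, ‖z - a‖ ^ ν' a := by
      rw [← Finset.mul_prod_erase s (fun a => ‖z - a‖ ^ ν a) ha₀s,
        ← Finset.mul_prod_erase s (fun a => ‖z - a‖ ^ ν' a) ha₀s]
      have e3 : ∏ a ∈ s.erase a₀, ‖z - a‖ ^ ν' a = ∏ a ∈ s.erase a₀, ‖z - a‖ ^ ν a :=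
        Finset.prod_congr rfl fun a ha => by
          rw [hν' a, if_neg (Finset.ne_of_mem_erase ha)]
      have e4 : ‖z - a₀‖ ^ ν a₀ = ‖z - a₀‖ * ‖z - a₀‖ ^ ν' a₀ := by
        rw [hν' a₀, if_pos rfl, ← pow_succ', Nat.sub_add_cancel hν₀]
      rw [e3, e4, mul_assoc]
    change ‖G z‖ ≤ _
    rw [hdiv hz, norm_mul, hprod, mul_left_comm]
    exact mul_le_mul_of_nonneg_left hHz (norm_nonneg _)

end Schwarz

/-! ### §2. The exponential `u ↦ exp (ψ u)` of a complete ultrametric `ℚ_p`-algebra field -/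

section Exp

variable {p : ℕ} [Fact p.Prime]
variable {E : Type*} [NontriviallyNormedField E] [CharZero E] [NormedAlgebra ℚ_[p] E]

omit [CharZero E] in
/-- **`p⁻¹ ≤` radius of convergence of the exponential series of `E` over itself**
(`‖1/n!‖_E = ‖1/n!‖_p ≤ p^{n-1}`; same computation as the tree's `PadicExp.le_expSeries_radius`,
which is over the scalars `ℚ_p`). [folklore] -/
theorem le_expSeries_radius_self :
    (((p : ℝ≥0)⁻¹ : ℝ≥0) : ℝ≥0∞) ≤ (expSeries E E).radius := by
  have hp : p.Prime := Fact.out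
  have hℓ : (0 : ℝ) < p := by exact_mod_cast hp.pos
  refine FormalMultilinearSeries.le_radius_of_bound _ 1 fun n => ?_
  have h1 : ‖expSeries E E n‖ ≤ (p : ℝ) ^ (n - 1) := by
    rw [expSeries, norm_smul, ContinuousMultilinearMap.norm_mkPiAlgebraFin, mul_one]
    have : ((n !⁻¹ : E)) = ((n ! : ℕ) : E)⁻¹ := by norm_cast
    rw [this]
    exact PadicExp.norm_inv_natCast_factorial_le (ℓ := p) n
  have h2 : (((p : ℝ≥0)⁻¹ : ℝ≥0) : ℝ) ^ n = ((p : ℝ) ^ n)⁻¹ := by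
    rw [NNReal.coe_inv, NNReal.coe_natCast, inv_pow]
  rw [h2]
  calc ‖expSeries E E n‖ * ((p : ℝ) ^ n)⁻¹ ≤ (p : ℝ) ^ (n - 1) * ((p : ℝ) ^ n)⁻¹ :=
        mul_le_mul_of_nonneg_right h1 (by positivity)
    _ ≤ (p : ℝ) ^ n * ((p : ℝ) ^ n)⁻¹ := by
        gcongr
        · exact_mod_cast hp.one_lt.le
        · exact Nat.sub_le n 1
    _ = 1 := mul_inv_cancel₀ (by positivity)

omit [CharZero E] in
/-- Points of the ball `‖a‖ < p⁻¹` lie in the disc of convergence of `expSeries E E`.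
[folklore] -/
theorem mem_eball_self {a : E} (ha : ‖a‖ < (p : ℝ)⁻¹) :
    a ∈ Metric.eball (0 : E) (expSeries E E).radius := by
  rw [mem_eball_zero_iff]
  refine lt_of_lt_of_le ?_ (le_expSeries_radius_self (p := p))
  rw [enorm_eq_nnnorm, ENNReal.coe_lt_coe, ← NNReal.coe_lt_coe, coe_nnnorm, NNReal.coe_inv,
    NNReal.coe_natCast]
  exact ha

variable [CompleteSpace E]

/-- `u ↦ exp (ψ u)` is analytic at `a` when `‖ψ a‖ < p⁻¹`. [folklore] -/
theorem analyticAt_exp_mul {ψ a : E} (h : ‖ψ * a‖ < (p : ℝ)⁻¹) :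
    AnalyticAt E (fun u : E => exp (ψ * u)) a := by
  have h1 : AnalyticAt E (exp : E → E) (ψ * a) :=
    analyticAt_exp_of_mem_ball (ψ * a) (mem_eball_self (p := p) h)
  have h2 : AnalyticAt E (fun u : E => ψ * u) a := by fun_prop
  exact h1.comp h2

/-- **`d/du exp (ψ u) = ψ exp (ψ u)`** at `a` when `‖ψ a‖ < p⁻¹`
(Mathlib `hasDerivAt_exp_smul_const_of_mem_ball'`). [folklore] -/
theorem hasDerivAt_exp_mul {ψ a : E} (h : ‖ψ * a‖ < (p : ℝ)⁻¹) :
    HasDerivAt (fun u : E => exp (ψ * u)) (ψ * exp (ψ * a)) a := by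
  have hmem : a • ψ ∈ Metric.eball (0 : E) (expSeries E E).radius := by
    rw [smul_eq_mul, mul_comm]
    exact mem_eball_self (p := p) h
  have hd := hasDerivAt_exp_smul_const_of_mem_ball' (𝕂 := E) ψ a hmem
  have e1 : (fun u : E => exp (u • ψ)) = fun u : E => exp (ψ * u) := by
    funext u; rw [smul_eq_mul, mul_comm]
  rw [e1, smul_eq_mul, mul_comm a ψ] at hd
  exact hd

omit [CharZero E] in
/-- **The expansion `exp (ψ u) = ∑ₖ (ψᵏ/k!) uᵏ`** for `‖ψ u‖ < p⁻¹`. [folklore] -/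
theorem hasSum_exp_mul {ψ u : E} (h : ‖ψ * u‖ < (p : ℝ)⁻¹) :
    HasSum (fun k : ℕ => ψ ^ k / (k ! : E) * u ^ k) (exp (ψ * u)) := by
  have hs := PadicExp.hasSum_exp (ℓ := p) h
  refine hs.congr_fun fun k => ?_
  rw [mul_pow]
  ring

omit [CharZero E] [CompleteSpace E] in
/-- The coefficients `ψᵏ/k!` have norm `≤ 1` when `‖ψ‖ ≤ p⁻¹` (`‖1/k!‖_p ≤ p^{k-1}`). [folklore] -/
theorem norm_pow_div_factorial_le_one {ψ : E} (hψ : ‖ψ‖ ≤ (p : ℝ)⁻¹) (k : ℕ) :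
    ‖ψ ^ k / (k ! : E)‖ ≤ 1 := by
  have hp : p.Prime := Fact.out
  have hℓ : (1 : ℝ) ≤ p := by exact_mod_cast hp.one_lt.le
  have hℓ0 : (0 : ℝ) < p := by positivity
  refine (PadicExp.norm_pow_div_factorial_le (ℓ := p) ψ k).trans ?_
  rcases Nat.eq_zero_or_pos k with rfl | hk
  · simp
  · obtain ⟨j, rfl⟩ : ∃ j, k = j + 1 := ⟨k - 1, by omega⟩
    calc ‖ψ‖ ^ (j + 1) * (p : ℝ) ^ (j + 1 - 1) ≤ ((p : ℝ)⁻¹) ^ (j + 1) * (p : ℝ) ^ (j + 1 - 1) := by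
          gcongr
      _ = (p : ℝ)⁻¹ := by
          rw [Nat.add_sub_cancel, pow_succ, inv_pow, mul_right_comm,
            inv_mul_cancel₀ (pow_ne_zero _ hℓ0.ne'), one_mul]
      _ ≤ 1 := inv_le_one_of_one_le₀ hℓ

omit [Fact p.Prime] [CharZero E] [NormedAlgebra ℚ_[p] E] [CompleteSpace E] in
/-- `‖ψ u‖ < p⁻¹` when `‖ψ‖ < p⁻¹` and `‖u‖ ≤ 1`. [folklore] -/
theorem norm_mul_lt_of_norm_le_one {ψ u : E} (hψ : ‖ψ‖ < (p : ℝ)⁻¹) (hu : ‖u‖ ≤ 1) :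
    ‖ψ * u‖ < (p : ℝ)⁻¹ := by
  rw [norm_mul]
  exact (mul_le_of_le_one_right (norm_nonneg _) hu).trans_lt hψ

/-! ### §3. The Schwarz lemma for exponential sums -/

variable [IsUltrametricDist E]

omit [CharZero E] [IsUltrametricDist E] in
/-- An exponential sum `f(u) = ∑ᵢ cᵢ exp (ψᵢ u)` with `‖ψᵢ‖ < p⁻¹` is, on the closed unit disc, the
sum of the power series `∑ₖ (∑ᵢ cᵢ ψᵢᵏ/k!) uᵏ`. [folklore] -/
theorem hasSum_expSum {ι : Type*} (t : Finset ι) (c ψ : ι → E)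
    (hψ : ∀ i ∈ t, ‖ψ i‖ < (p : ℝ)⁻¹) {u : E} (hu : ‖u‖ ≤ 1) :
    HasSum (fun k : ℕ => (∑ i ∈ t, c i * (ψ i ^ k / (k ! : E))) * u ^ k)
      (∑ i ∈ t, c i * exp (ψ i * u)) := by
  have h1 : ∀ i ∈ t, HasSum (fun k : ℕ => c i * (ψ i ^ k / (k ! : E) * u ^ k))
      (c i * exp (ψ i * u)) := fun i hi =>
    (hasSum_exp_mul (p := p) (norm_mul_lt_of_norm_le_one (hψ i hi) hu)).mul_left (c i)
  have h2 := hasSum_sum h1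
  refine h2.congr_fun fun k => ?_
  rw [Finset.sum_mul]
  exact Finset.sum_congr rfl fun i _ => by ring

omit [CharZero E] [CompleteSpace E] in
/-- The coefficients of that power series are bounded by any common bound `C` of the `‖cᵢ‖`.
[folklore] -/
theorem norm_expSum_coeff_le {ι : Type*} (t : Finset ι) (c ψ : ι → E) {C : ℝ} (hC : 0 ≤ C)
    (hc : ∀ i ∈ t, ‖c i‖ ≤ C) (hψ : ∀ i ∈ t, ‖ψ i‖ < (p : ℝ)⁻¹) (k : ℕ) :
    ‖∑ i ∈ t, c i * (ψ i ^ k / (k ! : E))‖ ≤ C := by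
  refine IsUltrametricDist.norm_sum_le_of_forall_le_of_nonneg hC fun i hi => ?_
  rw [norm_mul]
  exact (mul_le_of_le_one_right (norm_nonneg _)
    (norm_pow_div_factorial_le_one (hψ i hi).le k)).trans (hc i hi)

omit [IsUltrametricDist E] in
/-- An exponential sum is analytic at every point of the closed unit disc. [folklore] -/
theorem analyticAt_expSum {ι : Type*} (t : Finset ι) (c ψ : ι → E)
    (hψ : ∀ i ∈ t, ‖ψ i‖ < (p : ℝ)⁻¹) {a : E} (ha : ‖a‖ ≤ 1) :
    AnalyticAt E (fun u : E => ∑ i ∈ t, c i * exp (ψ i * u)) a := by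
  refine Finset.analyticAt_fun_sum t fun i hi => ?_
  exact analyticAt_const.mul (analyticAt_exp_mul (p := p) (norm_mul_lt_of_norm_le_one (hψ i hi) ha))

/-- **The `p`-adic Schwarz lemma for exponential sums.**  Let `f(u) = ∑ᵢ cᵢ exp (ψᵢ u)` with
`‖ψᵢ‖ < p⁻¹` and `‖cᵢ‖ ≤ C`.  If `f^{(j)}(a) = 0` for all `j < S` at every point `a` of a finite
subset `s` of the open unit disc, then `‖f(z)‖ ≤ C ∏_{a ∈ s} ‖z − a‖^S` for all `‖z‖ < 1`.
(The `p`-adic replacement of Baker 1975, Ch. 2, Lemma 4's "`θ|F(l)| ≥ Θ|f(l)|` by the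
maximum-modulus principle".) [folklore] -/
theorem norm_expSum_le_of_iteratedDeriv_eq_zero {ι : Type*} (t : Finset ι) (c ψ : ι → E) {C : ℝ}
    (hC : 0 ≤ C) (hc : ∀ i ∈ t, ‖c i‖ ≤ C) (hψ : ∀ i ∈ t, ‖ψ i‖ < (p : ℝ)⁻¹) (s : Finset E)
    (hs : ∀ a ∈ s, ‖a‖ < 1) (S : ℕ)
    (hS : ∀ a ∈ s, ∀ j < S, iteratedDeriv j (fun u : E => ∑ i ∈ t, c i * exp (ψ i * u)) a = 0)
    {z : E} (hz : ‖z‖ < 1) :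
    ‖∑ i ∈ t, c i * exp (ψ i * z)‖ ≤ C * ∏ a ∈ s, ‖z - a‖ ^ S := by
  set f : E → E := fun u => ∑ i ∈ t, c i * exp (ψ i * u) with hf
  set b : ℕ → E := fun k => ∑ i ∈ t, c i * (ψ i ^ k / (k ! : E)) with hb
  have hbC : ∀ k, ‖b k‖ ≤ C := norm_expSum_coeff_le t c ψ hC hc hψ
  set G : E → E := fun u => ∑' k, b k * u ^ k with hG
  have hfG : ∀ {u : E}, ‖u‖ ≤ 1 → f u = G u := fun hu =>
    ((hasSum_expSum (p := p) t c ψ hψ hu).tsum_eq).symm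
  -- orders of vanishing of `G`
  have hord : ∀ a ∈ s, ((S : ℕ) : ℕ∞) ≤ analyticOrderAt G a := by
    intro a ha
    have ha1 := hs a ha
    have hfa : AnalyticAt E f a := analyticAt_expSum (p := p) t c ψ hψ ha1.le
    have hfG' : f =ᶠ[𝓝 a] G := by
      filter_upwards [ball_one_mem_nhds ha1] with w hw using hfG (le_of_lt hw)
    rw [← analyticOrderAt_congr hfG', natCast_le_analyticOrderAt_iff_iteratedDeriv_eq_zero hfa]
    exact hS a ha
  have hmain := norm_tsum_mul_pow_le_mul_prod_pow s hs (∑ a ∈ s, S) (fun _ => S) rfl hbC hord hz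
  change ‖f z‖ ≤ _
  rw [hfG hz.le]
  exact hmain

/-! ### §4. The logarithmic series inverts the exponential -/

omit [CharZero E] in
/-- **`L(exp c) = c`** for `‖c‖ < p⁻¹`, where `L(y) = ∑ −(1−y)ⁿ⁺¹/(n+1)` is the logarithmic series
of a complete ultrametric normed `ℚ_p`-algebra field: both sides are the limit of
`((exp c)^{p^k} − 1)/p^k = (exp (p^k c) − 1)/p^k` (the tree's limit formula
`IwasawaLog.tendsto_pow_prime_pow_sub_one_div`, and `‖exp a − 1 − a‖ ≤ p‖a‖²`). [folklore] -/
theorem logSeries_exp {c : E} (hc : ‖c‖ < (p : ℝ)⁻¹) :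
    ∑' n : ℕ, -((1 - exp c) ^ (n + 1)) / (n + 1 : E) = c := by
  have hp : p.Prime := Fact.out
  have hp0 : (0 : ℝ) < p := by exact_mod_cast hp.pos
  have hpinv1 : (p : ℝ)⁻¹ < 1 := inv_lt_one_of_one_lt₀ (by exact_mod_cast hp.one_lt)
  -- `y = exp c` is a principal unit
  have hy : ‖1 - exp c‖ < 1 := by
    rw [norm_sub_rev, PadicExp.norm_exp_sub_one (ℓ := p) hc]
    exact hc.trans hpinv1
  have hlim := IwasawaLog.tendsto_pow_prime_pow_sub_one_div (p := p) (exp c) hy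
  -- the same sequence tends to `c`
  have hP0 : ∀ k : ℕ, ((p : E) ^ k) ≠ 0 := fun k => by
    refine pow_ne_zero k fun h0 => ?_
    have h1 : ‖(p : E)‖ = ‖(p : ℚ_[p])‖ := IwasawaLog.norm_natCast p (F := E) p
    rw [h0, norm_zero, Padic.norm_p] at h1
    exact (inv_pos.mpr hp0).ne' h1.symm
  have hnormP : ∀ k : ℕ, ‖(p : E) ^ k‖ ≤ 1 := fun k => by
    rw [norm_pow]
    exact pow_le_one₀ (norm_nonneg _) (IwasawaLog.norm_natCast_le_one p (F := E) p)
  have hak : ∀ k : ℕ, ‖(p : E) ^ k * c‖ < (p : ℝ)⁻¹ := fun k => by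
    rw [norm_mul]
    exact (mul_le_of_le_one_left (norm_nonneg _) (hnormP k)).trans_lt hc
  have heq : ∀ k : ℕ, ((exp c) ^ (p ^ k) - 1) / (p : E) ^ k - c =
      (exp ((p : E) ^ k * c) - 1 - (p : E) ^ k * c) / (p : E) ^ k := by
    intro k
    have e1 : (exp c) ^ (p ^ k) = exp ((p : E) ^ k * c) := by
      rw [← PadicExp.exp_natCast_mul (ℓ := p) hc (p ^ k)]
      push_cast
      rfl
    rw [e1]
    field_simp [hP0 k]
  have hlim' : Tendsto (fun k : ℕ => ((exp c) ^ (p ^ k) - 1) / (p : E) ^ k) atTop (𝓝 c) := by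
    have hzero : Tendsto (fun k : ℕ => ((exp c) ^ (p ^ k) - 1) / (p : E) ^ k - c) atTop (𝓝 0) := by
      refine squeeze_zero_norm (fun k => ?_)
        ((((tendsto_pow_atTop_nhds_zero_of_norm_lt_one
          (IwasawaLog.norm_prime_lt_one (p := p) (F := E))).norm).mul_const
            (‖c‖ * (‖c‖ * p))).trans_eq (by simp))
      rw [heq k, norm_div]
      have h1 := PadicExp.norm_exp_sub_one_sub_self_le (ℓ := p) (hak k)
      have hPk : 0 < ‖(p : E) ^ k‖ := norm_pos_iff.mpr (hP0 k)
      rw [div_le_iff₀ hPk]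
      refine h1.trans (le_of_eq ?_)
      rw [norm_mul]
      ring
    have := hzero.add_const c
    simpa using this
  exact tendsto_nhds_unique hlim hlim'

end Exp

end BrumerPadic

end Literature.NumberTheory.Transcendental

end
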